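import Summits.HodgeConjecture.HodgeConjecture.Theses.QbarEnvelope
import Summits.HodgeConjecture.HodgeConjecture.Theses.BoundaryReadout
import Literature.AlgebraicGeometry.HodgeTheory.AbsoluteHodgeClasses
import Literature.AlgebraicGeometry.HodgeTheory.MotivatedClassesLefschetzRange
import Literature.AlgebraicGeometry.HodgeTheory.LefschetzOneOneHolds
import Literature.AlgebraicGeometry.HodgeTheory.HardLefschetzNFoldHolds

/-!
# Line `derham-betti` for the crux `HCOverNumberFields` (stmt-HodgeConjecture-1070) —
# Hodge classes on arithmetic varieties descend to `ℚ̄` in de Rham cohomology; Hodge de Rham–Betti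
# classes are algebraic (the Grothendieck-period / analytic-subgroup door)

Strategist line (crux-strategist `cstrat-stmt-HodgeConjecture-1070-s1`, 2026-08-17), registered ALONGSIDE
`Lines/birth.lean` (Deligne's absolute-Hodge funnel) and `Lines/andre-transfer.lean` (André's motivated cut).

## The cut

`HCOverNumberFields` is the Hodge conjecture for `X ≅ X₀ ×_{K,σ₀} ℂ`, `K` a number field. The birth line
cuts it as (Hodge ⇒ ABSOLUTE Hodge: every conjugate under EVERY `σ ∈ Aut ℂ` is a twisted rational `(p,p)`
class on the conjugate variety `X^σ`) + (absolute Hodge ⇒ algebraic). This line cuts ONE STEP LOWER on the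
transcendence side and correspondingly HIGHER on the arithmetic side, along the subgroup
`Aut(ℂ/K')  ⊂  Aut ℂ` of automorphisms fixing a FINITE extension `K' = σ₀(K)(S)` (`S ⊂ ℚ̄` finite):

* STUB 2 (`stub_hodge_deRhamDescent`, OPEN — "Hodge classes on arithmetic varieties are de Rham–Betti
  over `ℚ̄`"): for a rational `(p,p)` class `c` on `X` there is a finite set `S` of ALGEBRAIC numbers such
  that for every `σ ∈ Aut ℂ` fixing `σ₀(K)` and `S` pointwise, every `σ`-conjugate of `c` is
  `(2πi/σ(2πi))ᵖ ·` (a rational `(p,p)` class on `X^σ`). For such `σ` one has `X^σ ≅ X` canonically, and the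
  condition says exactly that the algebraic de Rham incarnation `(2πi)ᵖ c ∈ H²ᵖ_dR(X₀/K) ⊗_K ℂ` has
  ALGEBRAIC coordinates, i.e. `((2πi)ᵖc, c)` is a de Rham–Betti class of `X₀ ⊗ ℚ̄` in the sense of
  Bost–Charles / Kreutz–Shen–Vial (a countable `Aut(ℂ/K')`-orbit forces algebraic coordinates). It is
  IMPLIED by "Hodge ⇒ absolute Hodge" (take `S = ∅`: `stub_hodge_deRhamDescent_of_absolute`, PROVED below;
  in print also via Deligne 1982 Prop. 2.9 / Charles–Schnell Cor. 11.3.16), hence a THEOREM on abelian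
  varieties (Deligne 1982 Thm. 2.11) and for motivated classes (André 1996); implied by HC (cycle classes
  are absolute Hodge). It is strictly WEAKER than the birth line's stub 2: the conjugate varieties `X^σ`,
  `σ ∉ Aut(ℂ/ℚ̄)` (Serre 1964 / Charles 2009: not even homeomorphic to `X` in general) never enter.
* STUB 3 (`stub_deRhamBettiHodge_algebraic`, OPEN, LOAD-BEARING — "Hodge de Rham–Betti classes on
  arithmetic varieties are algebraic"): a rational `(p,p)` class on `X` whose conjugates under
  `Aut(ℂ/σ₀(K)(S))`, `S ⊂ ℚ̄` finite, exist and are all twisted rational `(p,p)` classes IS ALGEBRAIC. This is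
  the restriction TO HODGE CLASSES of the de Rham–Betti conjecture ("the period conjecture of Grothendieck
  implies that de Rham–Betti classes should be algebraic", Kreutz–Shen–Vial 2022, abstract and §1;
  Bost–Charles 2016 §2; André, Panoramas 17, §7.5 and §23–24): GPC + standard conjectures ⇒ dR–B classes
  algebraic. Engines that exist ONLY behind this door: Wüstholz's analytic subgroup theorem (dR–B classes in
  `H²` of abelian varieties are algebraic: Bost 2013, Bost–Charles 2016 Thm.; on products of elliptic curves
  in EVERY codimension: Kreutz–Shen–Vial 2022 Thm. 1; codimension-2 dR–B classes on hyper-Kähler varieties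
  of known deformation type are Hodge, ibid.), the functional period conjecture (Ayoub; Bakker–Tsimerman
  2025), and the crystalline incarnation of a `ℚ̄`-de Rham class (Ogus's absolutely-Tate classes, `p`-adic
  variational Hodge: Bloch–Esnault–Kerz 2014). STUB 3 IMPLIES the birth line's stub 3
  (`birthStub3_of_stub_deRhamBettiHodge_algebraic`, PROVED: an absolute Hodge class satisfies the hypothesis
  with `S = ∅`) and is implied by the crux (`stub_deRhamBettiHodge_algebraic_of_crux`, PROVED: HC-safe, not
  stronger than the crux).
* STUB 1 (`stub_conjugate_exists`, INFRASTRUCTURE, theorem in print) — VERBATIM the stub of the same name of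
  `Lines/birth.lean` and of `Cruxes/BoundaryAbsoluteness/Lines/birth.lean` (one obligation, three lines):
  conjugates exist (Jouanolou's torsor + GAGA + de Rham + Grothendieck's comparison on a smooth affine).

Composition `HCOverNumberFields_of : stub₁ → stub₂ → stub₃ → QbarEnvelope.HCOverNumberFields` (pure logic +
the proved `QbarEnvelope.HodgeModels_holds`; kernel-checked, no `sorry`): STUB 2 supplies `S`, STUB 1 the
existence of conjugates for the `σ` fixing `σ₀(K) ∪ S`, STUB 3 concludes.

Why it dodges the hard step of `birth`: there the heart "absolute Hodge ⇒ algebraic" has no engine in print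
(beyond abelian fourfolds); here the heart is fed a class living in the finite-dimensional `ℚ̄`-vector space
`H²ᵖ_dR(X₀ ⊗ ℚ̄)` — with its Hodge filtration, Gauss–Manin connection over `ℚ̄`-bases and crystalline
Frobenii at all good primes — where transcendence theory (periods `(2πi)^{-p}∫_γ ω ∈ ℚ̄`) and `p`-adic Hodge
theory act; and the transcendence stub asks for NO conjugate variety. The two lines bracket the crux:
birth = (strong transcendence stub, weak arithmetic stub), this = (weak transcendence stub, strong
arithmetic stub), with both comparison hinges proved in this file.

Disproof used: none on file for stmt-1070 (no `Disproof.lean`, no `_false_without_`). Landed Negative lemmas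
checked against (imported in the scratch check `bc/derham_betti_negatives.lean` of the strategist folder, not here):
`Theorems/BallQuotientHodgeAbsolute/Negative/HodgeImpliesAbsoluteHodge.eq_zero_of_forall_isOfHodgeType_isAbsoluteHodgeClass`
— STUB 2 keeps `IsRationalClass c` (the rationality-free variant is absurd); `…nonempty_conjugationChart_of_isAbsoluteHodgeClass`
— chart existence is STUB 1, named, and STUB 3's hypothesis CARRIES the existence conjunct (so it is not
satisfiable vacuously by absence of charts); `…/Negative/ChartConjugationUniqueness.conjugates_unique_of_forall_rational`
— STUB 2 certifies single-valued chart conjugation only for `σ ∈ Aut(ℂ/K')` on Hodge classes of arithmetic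
varieties (a fragment of Grothendieck's comparison theorem, weaker than what birth's stub 2 certifies).
`ledger negatives --problem HodgeConjecture`: 3 entries, none about arithmetic varieties / conjugation.
-/

set_option linter.dupNamespace false

noncomputable section

namespace Summit.HodgeConjecture.HodgeConjecture.Cruxes.HCOverNumberFields.DeRhamBetti

open CategoryTheory AlgebraicGeometry
open Literature.AlgebraicGeometry.Motives Literature.AlgebraicGeometry.HodgeTheory
open Summit.HodgeConjecture.HodgeConjecture.Theses.QbarEnvelope (HCOverNumberFields HodgeModels_holds)

/-! ### The three registered stubs -/

/-- **STUB 1 (INFRASTRUCTURE — a theorem in print) — conjugates exist.** VERBATIM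
`stub_conjugate_exists` of `Lines/birth.lean` (and of `Cruxes/BoundaryAbsoluteness/Lines/birth.lean`): for
`X` smooth projective over `ℂ`, every `σ ∈ Aut ℂ`, degree `k` and class `c ∈ Hᵏ(X(ℂ); ℂ)` there is a
class on `X^σ` conjugate to `c` in some conjugation chart (Jouanolou's affine torsor `Y → X`, GAGA
analytifications of `Y`, `Y^σ`, the integration de Rham family, Grothendieck's algebraic de Rham theorem on
the smooth affine `Y`). Size L (tree infrastructure). [cite: Jouanolou1973, Lemme 1.5]
[cite: Grothendieck1966, Thm. 1'] [cite: CharlesSchnell2014Notes, §11.2.2] [cite: SerreGAGA1956, §2] -/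
theorem stub_conjugate_exists :
    ∀ ⦃n : ℕ⦄ ⦃X : SchemeOver ℂ⦄, IsSmoothProjective n X →
      ∀ (σ : ℂ ≃+* ℂ) (k : ℕ) (c : complexBetti X k), ∃ c', IsConjugateClass σ X k c c' := by
  sorry

/-- **STUB 2 (OPEN) — Hodge classes on arithmetic varieties DESCEND TO `ℚ̄` IN DE RHAM COHOMOLOGY.**
For `X ≅ X₀ ×_{K,σ₀} ℂ` (`K` a number field), `c ∈ H²ᵖ(X(ℂ); ℂ)` rational of Hodge type `(p,p)`: there is a
finite set `S` of ALGEBRAIC complex numbers such that for every `σ ∈ Aut ℂ` fixing `σ₀(K)` and `S`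
pointwise (i.e. `σ ∈ Aut(ℂ/K')`, `K' = σ₀(K)(S)` a finite extension), every `σ`-conjugate `c'` of `c` is
`(2πi/σ(2πi))ᵖ · β` with `β` rational of type `(p,p)` on `X^σ` (`≅ X` for these `σ`). Equivalently (fixed
field of `Aut(ℂ/K')` is `K'`; a countable orbit forces algebraic coordinates): `(2πi)ᵖ c` lies in
`H²ᵖ_dR(X₀/K) ⊗_K ℚ̄`, i.e. `c` is a `ℚ̄`-de Rham–Betti class. Why plausibly true: implied by "Hodge ⇒
absolute Hodge" (Charles–Schnell Conj. 11.2.17) with `S = ∅` (`stub_hodge_deRhamDescent_of_absolute`), hence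
a theorem on abelian varieties (Deligne 1982 Thm. 2.11 with Prop. 2.9) and for motivated classes (André
1996 Thm. 0.5); implied by HC (cycle classes have de Rham classes over their field of definition). Why it
might fail / why hard: a Hodge class with a transcendental period ratio `(2πi)^{-p}∫_γ ω ∉ ℚ̄` on an
arithmetic variety refutes it and HC; no engine off the abelian/motivated sector. The algebraicity of `S` is
essential: with arbitrary finite `S ⊂ ℂ` the statement is a triviality (every class has finitely many
complex coordinates) — recorded so that no repair drops it.
[cite: CharlesSchnell2014Notes, Conj. 11.2.17 and Cor. 11.3.16] [cite: Deligne1982HodgeCycles, Prop. 2.9 and Thm. 2.11]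
[cite: BostCharles2014, §2] [cite: arXiv:2206.08618, §1] -/
theorem stub_hodge_deRhamDescent :
    ∀ ⦃n : ℕ⦄ ⦃X : SchemeOver ℂ⦄, IsSmoothProjective n X →
      ∀ (K : Type) [Field K] [NumberField K] (σ₀ : K →+* ℂ) (X₀ : SchemeOver K),
        Nonempty (X ≅ (baseChangeHom σ₀).obj X₀) →
      ∀ (p : ℕ) (c : complexBetti X (2 * p)), IsRationalClass c → IsOfHodgeType n X (2 * p) p p c →
        ∃ S : Finset ℂ, (∀ s ∈ S, IsAlgebraic ℚ s) ∧
          ∀ σ : ℂ ≃+* ℂ, (∀ x : K, σ (σ₀ x) = σ₀ x) → (∀ s ∈ S, σ s = s) →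
            ∀ c' : complexBetti (conjugateVariety σ X) (2 * p), IsConjugateClass σ X (2 * p) c c' →
              ∃ β : complexBetti (conjugateVariety σ X) (2 * p),
                IsRationalClass β ∧ IsOfHodgeType n (conjugateVariety σ X) (2 * p) p p β ∧
                  c' = periodTwist σ p • β := by
  sorry

/-- **STUB 3 (OPEN, LOAD-BEARING) — Hodge de Rham–Betti classes on arithmetic varieties are algebraic.**
For `X ≅ X₀ ×_{K,σ₀} ℂ` and `c ∈ H²ᵖ(X(ℂ); ℂ)` rational of type `(p,p)`: IF for some finite set `S` of
algebraic numbers every `σ ∈ Aut(ℂ/σ₀(K)(S))` admits a conjugate of `c` and all such conjugates are twisted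
rational `(p,p)` classes (i.e. `c` is a `ℚ̄`-de Rham–Betti Hodge class), THEN `c ∈ algebraicClasses X p`.
Why plausibly true: it is the restriction to Hodge classes of the de Rham–Betti conjecture, itself implied
by the Grothendieck period conjecture + standard conjectures (Bost–Charles 2016 §2; Kreutz–Shen–Vial 2022
§1; André 2004 §7.5); known engines: Wüstholz's analytic subgroup theorem (dR–B classes in `H²` of abelian
varieties algebraic — Bost, Bost–Charles; all codimensions on products of elliptic curves and on powers of
abelian surfaces with extra endomorphisms — Kreutz–Shen–Vial 2022 Thm. 1), Kuga–Satake (hyper-Kähler `H²`,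
codimension-2 dR–B classes on known HK are Hodge), functional GPC (Ayoub, Bakker–Tsimerman), and the
crystalline Frobenius of a `ℚ̄`-de Rham class (Ogus 1982; Bloch–Esnault–Kerz 2014). Why it might fail / why
hard: beyond `H²`/elliptic products no dR–B algebraicity is known; it contains the Weil classes on CM abelian
varieties of Weil type (dR–B by Deligne), algebraic only in dim 4 / partly 6 (Markman 2025). HC-safe (implied
by the crux: `stub_deRhamBettiHodge_algebraic_of_crux`); implies birth's stub 3
(`birthStub3_of_stub_deRhamBettiHodge_algebraic`). [cite: BostCharles2014, §2 and Thm. 5.1]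
[cite: arXiv:2206.08618, Thm. 1 and §1] [cite: Andre2004, §7.5] [cite: Markman2025SecantWeil, §1.1]
[cite: Deligne1982HodgeCycles, Thm. 2.11] -/
theorem stub_deRhamBettiHodge_algebraic :
    ∀ ⦃n : ℕ⦄ ⦃X : SchemeOver ℂ⦄, IsSmoothProjective n X →
      ∀ (K : Type) [Field K] [NumberField K] (σ₀ : K →+* ℂ) (X₀ : SchemeOver K),
        Nonempty (X ≅ (baseChangeHom σ₀).obj X₀) →
      ∀ (p : ℕ) (c : complexBetti X (2 * p)), IsRationalClass c → IsOfHodgeType n X (2 * p) p p c →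
        (∃ S : Finset ℂ, (∀ s ∈ S, IsAlgebraic ℚ s) ∧
          ∀ σ : ℂ ≃+* ℂ, (∀ x : K, σ (σ₀ x) = σ₀ x) → (∀ s ∈ S, σ s = s) →
            (∃ c', IsConjugateClass σ X (2 * p) c c') ∧
            ∀ c' : complexBetti (conjugateVariety σ X) (2 * p), IsConjugateClass σ X (2 * p) c c' →
              ∃ β : complexBetti (conjugateVariety σ X) (2 * p),
                IsRationalClass β ∧ IsOfHodgeType n (conjugateVariety σ X) (2 * p) p p β ∧
                  c' = periodTwist σ p • β) →
        c ∈ algebraicClasses X p := by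
  sorry

/-! ### The composition: stub₁ → stub₂ → stub₃ → the crux, by name (no `sorry`) -/

/-- **THE LINE'S COMPOSITION** (kernel-checked, no `sorry`): if conjugates exist (STUB 1), Hodge
classes on arithmetic varieties descend to `ℚ̄` in de Rham cohomology (STUB 2), and Hodge de Rham–Betti
classes on arithmetic varieties are algebraic (STUB 3), then `HCOverNumberFields`: the anti-vacuity
conjunct is the proved `QbarEnvelope.HodgeModels_holds`; for a rational `(p,p)` class `c` on
`X ≅ X₀ ×_{K,σ₀} ℂ`, STUB 2 gives `S`, STUB 1 the conjugates for the `σ` fixing `σ₀(K) ∪ S`, and STUB 3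
concludes. Concludes the crux BY NAME. [cite: BostCharles2014, §2] [cite: CharlesSchnell2014Notes, §11.2.5] -/
theorem HCOverNumberFields_of
    (h₁ : ∀ ⦃n : ℕ⦄ ⦃X : SchemeOver ℂ⦄, IsSmoothProjective n X →
      ∀ (σ : ℂ ≃+* ℂ) (k : ℕ) (c : complexBetti X k), ∃ c', IsConjugateClass σ X k c c')
    (h₂ : ∀ ⦃n : ℕ⦄ ⦃X : SchemeOver ℂ⦄, IsSmoothProjective n X →
      ∀ (K : Type) [Field K] [NumberField K] (σ₀ : K →+* ℂ) (X₀ : SchemeOver K),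
        Nonempty (X ≅ (baseChangeHom σ₀).obj X₀) →
      ∀ (p : ℕ) (c : complexBetti X (2 * p)), IsRationalClass c → IsOfHodgeType n X (2 * p) p p c →
        ∃ S : Finset ℂ, (∀ s ∈ S, IsAlgebraic ℚ s) ∧
          ∀ σ : ℂ ≃+* ℂ, (∀ x : K, σ (σ₀ x) = σ₀ x) → (∀ s ∈ S, σ s = s) →
            ∀ c' : complexBetti (conjugateVariety σ X) (2 * p), IsConjugateClass σ X (2 * p) c c' →
              ∃ β : complexBetti (conjugateVariety σ X) (2 * p),
                IsRationalClass β ∧ IsOfHodgeType n (conjugateVariety σ X) (2 * p) p p β ∧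
                  c' = periodTwist σ p • β)
    (h₃ : ∀ ⦃n : ℕ⦄ ⦃X : SchemeOver ℂ⦄, IsSmoothProjective n X →
      ∀ (K : Type) [Field K] [NumberField K] (σ₀ : K →+* ℂ) (X₀ : SchemeOver K),
        Nonempty (X ≅ (baseChangeHom σ₀).obj X₀) →
      ∀ (p : ℕ) (c : complexBetti X (2 * p)), IsRationalClass c → IsOfHodgeType n X (2 * p) p p c →
        (∃ S : Finset ℂ, (∀ s ∈ S, IsAlgebraic ℚ s) ∧
          ∀ σ : ℂ ≃+* ℂ, (∀ x : K, σ (σ₀ x) = σ₀ x) → (∀ s ∈ S, σ s = s) →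
            (∃ c', IsConjugateClass σ X (2 * p) c c') ∧
            ∀ c' : complexBetti (conjugateVariety σ X) (2 * p), IsConjugateClass σ X (2 * p) c c' →
              ∃ β : complexBetti (conjugateVariety σ X) (2 * p),
                IsRationalClass β ∧ IsOfHodgeType n (conjugateVariety σ X) (2 * p) p p β ∧
                  c' = periodTwist σ p • β) →
        c ∈ algebraicClasses X p) :
    Summit.HodgeConjecture.HodgeConjecture.Theses.QbarEnvelope.HCOverNumberFields := by
  rintro n X hX ⟨K, _, _, σ₀, X₀, hm⟩
  refine ⟨(HodgeModels_holds n X).nonempty hX, fun p c hc hpp ↦ ?_⟩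
  obtain ⟨S, hS, hσ⟩ := h₂ hX K σ₀ X₀ hm p c hc hpp
  exact h₃ hX K σ₀ X₀ hm p c hc hpp ⟨S, hS, fun σ hK hSσ ↦ ⟨h₁ hX σ (2 * p) c, hσ σ hK hSσ⟩⟩

/-- **The crux, closed modulo exactly the three registered stubs.** -/
theorem HCOverNumberFields_of_stubs :
    Summit.HodgeConjecture.HodgeConjecture.Theses.QbarEnvelope.HCOverNumberFields :=
  HCOverNumberFields_of stub_conjugate_exists stub_hodge_deRhamDescent stub_deRhamBettiHodge_algebraic

/-- The same in the `BoundaryReadout` spelling of the shared item (definitionally the same statement). -/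
theorem boundaryReadout_HCOverNumberFields_of_stubs :
    Summit.HodgeConjecture.HodgeConjecture.Theses.BoundaryReadout.HCOverNumberFields :=
  HCOverNumberFields_of_stubs

/-! ### Hinges with the birth line (proved): this line = (weaker stub 2, stronger stub 3) -/

/-- **Absolute Hodge ⇒ de Rham descent with `S = ∅`**: an absolute Hodge class satisfies the conclusion of
STUB 2 (its conjugation clause holds for EVERY `σ`, a fortiori for those fixing `σ₀(K)`). Hence birth's
stub 2 ("conjugates of Hodge classes on arithmetic varieties are twisted rational `(p,p)`, all `σ`") implies
STUB 2 formally. [cite: CharlesSchnell2014Notes, Def. 11.2.3] -/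
theorem deRhamDescent_of_isAbsoluteHodgeClass {n : ℕ} {X : SchemeOver ℂ} {p : ℕ}
    {c : complexBetti X (2 * p)} (h : IsAbsoluteHodgeClass n X p c)
    (K : Type) [Field K] (σ₀ : K →+* ℂ) :
    ∃ S : Finset ℂ, (∀ s ∈ S, IsAlgebraic ℚ s) ∧
      ∀ σ : ℂ ≃+* ℂ, (∀ x : K, σ (σ₀ x) = σ₀ x) → (∀ s ∈ S, σ s = s) →
        (∃ c', IsConjugateClass σ X (2 * p) c c') ∧
        ∀ c' : complexBetti (conjugateVariety σ X) (2 * p), IsConjugateClass σ X (2 * p) c c' →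
          ∃ β : complexBetti (conjugateVariety σ X) (2 * p),
            IsRationalClass β ∧ IsOfHodgeType n (conjugateVariety σ X) (2 * p) p p β ∧
              c' = periodTwist σ p • β :=
  ⟨∅, fun _ h ↦ absurd h (Finset.notMem_empty _), fun σ _ _ ↦ h.2.2 σ⟩

/-- **Birth's stub 2 ⇒ STUB 2** (formal, `S = ∅`): the birth line's transcendence stub (all of `Aut ℂ`)
implies this line's (only `Aut(ℂ/K')`). [cite: CharlesSchnell2014Notes, Conj. 11.2.17] -/
theorem stub_hodge_deRhamDescent_of_absolute
    (hb : ∀ ⦃n : ℕ⦄ ⦃X : SchemeOver ℂ⦄, IsSmoothProjective n X →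
      (∃ (K : Type) (_ : Field K) (_ : NumberField K) (σ : K →+* ℂ) (X₀ : SchemeOver K),
        Nonempty (X ≅ (baseChangeHom σ).obj X₀)) →
      ∀ (p : ℕ) (c : complexBetti X (2 * p)), IsRationalClass c → IsOfHodgeType n X (2 * p) p p c →
        ∀ (σ : ℂ ≃+* ℂ) (c' : complexBetti (conjugateVariety σ X) (2 * p)),
          IsConjugateClass σ X (2 * p) c c' →
            ∃ β : complexBetti (conjugateVariety σ X) (2 * p),
              IsRationalClass β ∧ IsOfHodgeType n (conjugateVariety σ X) (2 * p) p p β ∧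
                c' = periodTwist σ p • β) :
    ∀ ⦃n : ℕ⦄ ⦃X : SchemeOver ℂ⦄, IsSmoothProjective n X →
      ∀ (K : Type) [Field K] [NumberField K] (σ₀ : K →+* ℂ) (X₀ : SchemeOver K),
        Nonempty (X ≅ (baseChangeHom σ₀).obj X₀) →
      ∀ (p : ℕ) (c : complexBetti X (2 * p)), IsRationalClass c → IsOfHodgeType n X (2 * p) p p c →
        ∃ S : Finset ℂ, (∀ s ∈ S, IsAlgebraic ℚ s) ∧
          ∀ σ : ℂ ≃+* ℂ, (∀ x : K, σ (σ₀ x) = σ₀ x) → (∀ s ∈ S, σ s = s) →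
            ∀ c' : complexBetti (conjugateVariety σ X) (2 * p), IsConjugateClass σ X (2 * p) c c' →
              ∃ β : complexBetti (conjugateVariety σ X) (2 * p),
                IsRationalClass β ∧ IsOfHodgeType n (conjugateVariety σ X) (2 * p) p p β ∧
                  c' = periodTwist σ p • β :=
  fun _ _ hX K _ _ σ₀ X₀ hm p c hc hpp ↦
    ⟨∅, fun _ h ↦ absurd h (Finset.notMem_empty _),
      fun σ _ _ c' hc' ↦ hb hX ⟨K, inferInstance, inferInstance, σ₀, X₀, hm⟩ p c hc hpp σ c' hc'⟩

/-- **STUB 3 ⇒ birth's stub 3** (formal): an absolute Hodge class on an arithmetic variety satisfies the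
hypothesis of STUB 3 with `S = ∅` (`deRhamDescent_of_isAbsoluteHodgeClass`), so "Hodge dR–B classes are
algebraic" gives "absolute Hodge classes on arithmetic varieties are algebraic".
[cite: Voisin2007HodgeLoci, Prop. 1.2] [cite: CharlesSchnell2014Notes, Cor. 11.3.16] -/
theorem birthStub3_of_stub_deRhamBettiHodge_algebraic
    (h₃ : ∀ ⦃n : ℕ⦄ ⦃X : SchemeOver ℂ⦄, IsSmoothProjective n X →
      ∀ (K : Type) [Field K] [NumberField K] (σ₀ : K →+* ℂ) (X₀ : SchemeOver K),
        Nonempty (X ≅ (baseChangeHom σ₀).obj X₀) →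
      ∀ (p : ℕ) (c : complexBetti X (2 * p)), IsRationalClass c → IsOfHodgeType n X (2 * p) p p c →
        (∃ S : Finset ℂ, (∀ s ∈ S, IsAlgebraic ℚ s) ∧
          ∀ σ : ℂ ≃+* ℂ, (∀ x : K, σ (σ₀ x) = σ₀ x) → (∀ s ∈ S, σ s = s) →
            (∃ c', IsConjugateClass σ X (2 * p) c c') ∧
            ∀ c' : complexBetti (conjugateVariety σ X) (2 * p), IsConjugateClass σ X (2 * p) c c' →
              ∃ β : complexBetti (conjugateVariety σ X) (2 * p),
                IsRationalClass β ∧ IsOfHodgeType n (conjugateVariety σ X) (2 * p) p p β ∧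
                  c' = periodTwist σ p • β) →
        c ∈ algebraicClasses X p) :
    ∀ ⦃n : ℕ⦄ ⦃X : SchemeOver ℂ⦄, IsSmoothProjective n X →
      (∃ (K : Type) (_ : Field K) (_ : NumberField K) (σ : K →+* ℂ) (X₀ : SchemeOver K),
        Nonempty (X ≅ (baseChangeHom σ).obj X₀)) →
      ∀ (p : ℕ) (c : complexBetti X (2 * p)), IsAbsoluteHodgeClass n X p c →
        c ∈ algebraicClasses X p := by
  rintro n X hX ⟨K, _, _, σ₀, X₀, hm⟩ p c habs
  exact h₃ hX K σ₀ X₀ hm p c habs.1 habs.2.1 (deRhamDescent_of_isAbsoluteHodgeClass habs K σ₀)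

/-! ### Sanity: HC-safety (tightness) and special cases (BC5), proved outright -/

/-- **Tightness: STUB 3 is implied by the crux** (it is not stronger than `HCOverNumberFields`: the crux
makes every rational `(p,p)` class on an arithmetic variety algebraic, hypothesis or not). [folklore] -/
theorem stub_deRhamBettiHodge_algebraic_of_crux (h : HCOverNumberFields) :
    ∀ ⦃n : ℕ⦄ ⦃X : SchemeOver ℂ⦄, IsSmoothProjective n X →
      ∀ (K : Type) [Field K] [NumberField K] (σ₀ : K →+* ℂ) (X₀ : SchemeOver K),
        Nonempty (X ≅ (baseChangeHom σ₀).obj X₀) →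
      ∀ (p : ℕ) (c : complexBetti X (2 * p)), IsRationalClass c → IsOfHodgeType n X (2 * p) p p c →
        (∃ S : Finset ℂ, (∀ s ∈ S, IsAlgebraic ℚ s) ∧
          ∀ σ : ℂ ≃+* ℂ, (∀ x : K, σ (σ₀ x) = σ₀ x) → (∀ s ∈ S, σ s = s) →
            (∃ c', IsConjugateClass σ X (2 * p) c c') ∧
            ∀ c' : complexBetti (conjugateVariety σ X) (2 * p), IsConjugateClass σ X (2 * p) c c' →
              ∃ β : complexBetti (conjugateVariety σ X) (2 * p),
                IsRationalClass β ∧ IsOfHodgeType n (conjugateVariety σ X) (2 * p) p p β ∧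
                  c' = periodTwist σ p • β) →
        c ∈ algebraicClasses X p :=
  fun _ _ hX K _ _ σ₀ X₀ hm p c hc hpp _ ↦ (h hX ⟨K, inferInstance, inferInstance, σ₀, X₀, hm⟩).2 p c hc hpp

/-- **BC5 (a): STUB 3 holds outright in the Lefschetz range** `p ≤ 1 ∨ n ≤ p + 1` (every rational `(p,p)`
class there is algebraic on any smooth projective complex variety: `p = 0`, Lefschetz `(1,1)`, hard
Lefschetz, `p > n`; tree theorem `mem_algebraicClasses_of_lefschetzRange`). So the open content of the
line starts at arithmetic fourfolds, `p = 2`. [cite: VoisinHodgeI2002, Thm. 6.25 and Thm. 11.30] -/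
theorem stub_deRhamBettiHodge_algebraic_lefschetzRange :
    ∀ ⦃n : ℕ⦄ ⦃X : SchemeOver ℂ⦄, IsSmoothProjective n X →
      ∀ (p : ℕ), (p ≤ 1 ∨ n ≤ p + 1) →
        ∀ (c : complexBetti X (2 * p)), IsRationalClass c → IsOfHodgeType n X (2 * p) p p c →
          c ∈ algebraicClasses X p :=
  fun n X hX _ hp c hc hpp ↦
    mem_algebraicClasses_of_lefschetzRange lefschetzOneOne_rational_holds
      (nonempty_hardLefschetzNFold_holds n X) hX hp c hc hpp

/-- **BC5 (b): the crux for `n ≤ 3`, unconditionally** (Lefschetz range in every codimension; Hodge models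
by `QbarEnvelope.HodgeModels_holds`). [cite: VoisinHodgeI2002, Thm. 11.30] -/
theorem hcOverNumberFields_of_le_three :
    ∀ ⦃n : ℕ⦄ ⦃X : SchemeOver ℂ⦄, n ≤ 3 → IsSmoothProjective n X → HodgeConjectureFor n X :=
  fun n X hn hX ↦
    ⟨(HodgeModels_holds n X).nonempty hX,
      fun p c hc hpp ↦ stub_deRhamBettiHodge_algebraic_lefschetzRange hX p (by omega) c hc hpp⟩

/-- **The zero class satisfies STUB 2's clause in any chart-independent way only modulo single-valuedness**:
what IS formal is that `0` has the conjugate `0` whenever a chart exists (`isConjugateClass_zero`) — recorded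
as the degenerate witness of the `∃ c'` conjunct fed by STUB 1. [folklore] -/
theorem exists_conjugate_zero {σ : ℂ ≃+* ℂ} {X : SchemeOver ℂ} {k : ℕ} (D : ConjugationChart σ X k) :
    ∃ c', IsConjugateClass σ X k (0 : complexBetti X k) c' :=
  ⟨0, isConjugateClass_zero D⟩

end Summit.HodgeConjecture.HodgeConjecture.Cruxes.HCOverNumberFields.DeRhamBetti

end
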